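import Literature.NumberTheory.EllipticCurves.Gamma1PeriodLatticeTwistProofs
import Literature.NumberTheory.EllipticCurves.IsogenyDegreeLatticeIndexProofs
import Mathlib.GroupTheory.IndexNSmul
import HarnessLib

/-!
# Period-lattice index parity (route `TeichmullerTwistDescent`, LINE 11, K stmt-BirchSwinnertonDyer-25368)

Cell `pub/bsd-wall`, seat `bsd-line-ttd-p1` (g5). THEOREMS ONLY, route-independent (Literature + Mathlib
imports). Three elementary lemmas feeding `TeichmullerTwistDescentTwistedPeriodLatticeDichotomy.lean`
(the registered stub `stub_dichotomy` of K modulo modularity):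

* `eq_of_isQuadratic_of_ne_one` — there is only ONE non-trivial quadratic Dirichlet character modulo a
  prime (both are `-1` at a generator of `(ℤ/p)ˣ`);
* `relIndex_map_mulLeft_intCast_self` — `[Λ : kΛ] = |k|²` for the lattice of a period pair
  (Mathlib `AddSubgroup.relIndex_map_nsmul`, rank `2`);
* `le_or_le_of_prime_sandwich` — **index parity**: if `pΛ ⊆ A ⊆ Λ`, `kΛ ⊆ A` and `p ∤ [A : kΛ]`, then
  `A = Λ` or `A = pΛ` (`[Λ : A] ∣ p²` and `[Λ : A]·[A : kΛ] = k²`, so `[Λ : A] = p` would force `p ∣ k`,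
  `p² ∣ p·[A : kΛ]`).
BSD is not proved by this. [folklore]
-/

set_option autoImplicit false
-- single-conjunct summit: `Summit.BirchSwinnertonDyer.BirchSwinnertonDyer.…` repeats the name by design
set_option linter.dupNamespace false

noncomputable section

open scoped Classical

namespace Summit.BirchSwinnertonDyer.BirchSwinnertonDyer.Theorems.TeichmullerTwistDescent.PeriodLatticeIndexParity

/-! ### §0 Two elementary lemmas -/

/-- **There is only one non-trivial quadratic Dirichlet character modulo a prime `p`**: two quadratic
(`{0, ±1}`-valued) characters mod `p` that are both `≠ 1` coincide — both take the value `-1` at a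
generator of the cyclic group `(ℤ/p)ˣ`. [folklore] -/
theorem eq_of_isQuadratic_of_ne_one {p : ℕ} [Fact p.Prime] {χ χ' : DirichletCharacter ℂ p}
    (hχ : χ.IsQuadratic) (h1 : χ ≠ 1) (hχ' : χ'.IsQuadratic) (h1' : χ' ≠ 1) : χ = χ' := by
  obtain ⟨g, hg⟩ := IsCyclic.exists_generator (α := (ZMod p)ˣ)
  -- a non-trivial quadratic character is `-1` at the generator
  have key : ∀ ψ : DirichletCharacter ℂ p, ψ.IsQuadratic → ψ ≠ 1 → ψ (g : ZMod p) = -1 := by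
    intro ψ hq hne
    rcases hq (g : ZMod p) with h0 | h1 | hm1
    · exact absurd h0 (by
        rw [← MulChar.coe_toUnitHom]
        exact (ψ.toUnitHom g).ne_zero)
    · exfalso
      apply hne
      apply MulChar.ext
      intro a
      obtain ⟨k, rfl⟩ := Subgroup.mem_zpowers_iff.mp (hg a)
      have hu : ψ.toUnitHom g = 1 := Units.ext (by rw [MulChar.coe_toUnitHom, h1, Units.val_one])
      rw [← MulChar.coe_toUnitHom, map_zpow, hu, one_zpow, Units.val_one, MulChar.one_apply_coe]
    · exact hm1
  have hu : χ.toUnitHom g = χ'.toUnitHom g :=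
    Units.ext (by rw [MulChar.coe_toUnitHom, MulChar.coe_toUnitHom, key χ hχ h1, key χ' hχ' h1'])
  apply MulChar.ext
  intro a
  obtain ⟨k, rfl⟩ := Subgroup.mem_zpowers_iff.mp (hg a)
  rw [← MulChar.coe_toUnitHom, ← MulChar.coe_toUnitHom, map_zpow, map_zpow, hu]

/-- `aΛ` of `bΛ` is `(ab)Λ` (composition of left multiplications on subgroups of `ℂ`). [folklore] -/
theorem map_mulLeft_map_mulLeft (S : AddSubgroup ℂ) (a b : ℂ) :
    (S.map (AddMonoidHom.mulLeft b)).map (AddMonoidHom.mulLeft a) =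
      S.map (AddMonoidHom.mulLeft (a * b)) := by
  rw [AddSubgroup.map_map]
  congr 1
  ext z
  simp [mul_assoc]

/-- **`[Λ : kΛ] = |k|²`** for the lattice `Λ = ℤω₁ ⊕ ℤω₂` of a period pair and a non-zero integer
`k` (free `ℤ`-module of rank `2`; Mathlib `AddSubgroup.relIndex_map_nsmul`). [folklore] -/
theorem relIndex_map_mulLeft_intCast_self (L : PeriodPair) (k : ℤ) :
    (L.lattice.toAddSubgroup.map (AddMonoidHom.mulLeft ((k : ℂ)))).relIndex L.lattice.toAddSubgroup =
      k.natAbs ^ 2 := by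
  have hmap : L.lattice.toAddSubgroup.map (AddMonoidHom.mulLeft ((k : ℂ))) =
      L.lattice.toAddSubgroup.map (nsmulAddMonoidHom (α := ℂ) k.natAbs) := by
    ext x
    simp only [AddSubgroup.mem_map, Submodule.mem_toAddSubgroup, AddMonoidHom.coe_mulLeft,
      nsmulAddMonoidHom_apply, nsmul_eq_mul]
    rcases Int.natAbs_eq k with h | h
    · have hk : (k : ℂ) = (k.natAbs : ℂ) := by
        have h' := congrArg (fun t : ℤ ↦ (t : ℂ)) h
        simpa only [Int.cast_natCast] using h'
      constructor
      · rintro ⟨z, hz, rfl⟩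
        exact ⟨z, hz, by rw [hk]⟩
      · rintro ⟨z, hz, rfl⟩
        exact ⟨z, hz, by rw [hk]⟩
    · have hk : (k : ℂ) = -(k.natAbs : ℂ) := by
        have h' := congrArg (fun t : ℤ ↦ (t : ℂ)) h
        simpa only [Int.cast_neg, Int.cast_natCast] using h'
      constructor
      · rintro ⟨z, hz, rfl⟩
        exact ⟨-z, neg_mem hz, by rw [hk]; ring⟩
      · rintro ⟨z, hz, rfl⟩
        exact ⟨-z, neg_mem hz, by rw [hk]; ring⟩
  rw [hmap]
  haveI : Module.Free ℤ ↥(L.lattice.toAddSubgroup.toIntSubmodule) := Module.Free.of_basis L.latticeBasis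
  haveI : Module.Finite ℤ ↥(L.lattice.toAddSubgroup.toIntSubmodule) :=
    Module.Finite.of_basis L.latticeBasis
  rw [AddSubgroup.relIndex_map_nsmul]
  congr 1
  -- the rank of `Λ` as a bare additive group (canonical `ℤ`-module structure) is `2`
  let e : ↥L.lattice ≃ₗ[ℤ] ↥L.lattice.toAddSubgroup := (AddEquiv.refl ↥L.lattice).toIntLinearEquiv
  have h := Module.finrank_eq_card_basis (L.latticeBasis.map e)
  rw [Fintype.card_fin] at h
  exact h

/-! ### §1 The parity argument: a prime sandwich `pΛ ⊆ A ⊆ Λ` whose relative index divides a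
square times a number prime to `p` is trivial -/

/-- **Index parity.** Let `Λ ⊂ ℂ` be the lattice of a period pair, `p` a prime, `A` a subgroup with
`pΛ ⊆ A ⊆ Λ`, and `k ≠ 0` an integer with `kΛ ⊆ A` and `p ∤ [A : kΛ]`. Then `A = Λ` or `A = pΛ`:
`[Λ : A]` divides `[Λ : pΛ] = p²`, and `[Λ : A]·[A : kΛ] = [Λ : kΛ] = k²`; the middle case
`[Λ : A] = p` would give `p ∣ k²`, `p ∣ k`, `p² ∣ k² = p·[A : kΛ]`, `p ∣ [A : kΛ]`. [folklore] -/
theorem le_or_le_of_prime_sandwich (L : PeriodPair) {p : ℕ} (hp : p.Prime) {A : AddSubgroup ℂ}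
    (hA : A ≤ L.lattice.toAddSubgroup)
    (hpA : L.lattice.toAddSubgroup.map (AddMonoidHom.mulLeft (p : ℂ)) ≤ A)
    {k : ℤ} (hkA : L.lattice.toAddSubgroup.map (AddMonoidHom.mulLeft (k : ℂ)) ≤ A)
    (hd : ¬ p ∣ (L.lattice.toAddSubgroup.map (AddMonoidHom.mulLeft (k : ℂ))).relIndex A) :
    L.lattice.toAddSubgroup ≤ A ∨ A ≤ L.lattice.toAddSubgroup.map (AddMonoidHom.mulLeft (p : ℂ)) := by
  have hpp : (L.lattice.toAddSubgroup.map (AddMonoidHom.mulLeft (p : ℂ))).relIndex A *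
      A.relIndex L.lattice.toAddSubgroup = p ^ 2 := by
    rw [AddSubgroup.relIndex_mul_relIndex _ _ _ hpA hA]
    have h := relIndex_map_mulLeft_intCast_self L (p : ℤ)
    rw [Int.cast_natCast, Int.natAbs_natCast] at h
    exact h
  have hkk : (L.lattice.toAddSubgroup.map (AddMonoidHom.mulLeft (k : ℂ))).relIndex A *
      A.relIndex L.lattice.toAddSubgroup = k.natAbs ^ 2 := by
    rw [AddSubgroup.relIndex_mul_relIndex _ _ _ hkA hA]
    exact relIndex_map_mulLeft_intCast_self L k
  have hi : A.relIndex L.lattice.toAddSubgroup ∣ p ^ 2 := Dvd.intro_left _ hpp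
  obtain ⟨m, hm, him⟩ := (Nat.dvd_prime_pow hp).1 hi
  interval_cases m
  · left
    rw [pow_zero] at him
    exact AddSubgroup.relIndex_eq_one.mp him
  · exfalso
    rw [pow_one] at him
    rw [him] at hkk
    apply hd
    have h1 : p ∣ k.natAbs ^ 2 := Dvd.intro_left _ hkk
    have h2 : p ∣ k.natAbs := hp.dvd_of_dvd_pow h1
    have h3 : p ^ 2 ∣ k.natAbs ^ 2 := pow_dvd_pow_of_dvd h2 2
    rw [← hkk, pow_two] at h3
    exact (Nat.mul_dvd_mul_iff_right hp.pos).mp h3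
  · right
    rw [him] at hpp
    have h1 : (L.lattice.toAddSubgroup.map (AddMonoidHom.mulLeft (p : ℂ))).relIndex A = 1 := by
      have hp0 : 0 < p ^ 2 := pow_pos hp.pos 2
      have h2 : (L.lattice.toAddSubgroup.map (AddMonoidHom.mulLeft (p : ℂ))).relIndex A * p ^ 2 =
          1 * p ^ 2 := by rw [hpp, one_mul]
      exact Nat.eq_of_mul_eq_mul_right hp0 h2
    exact AddSubgroup.relIndex_eq_one.mp h1


end Summit.BirchSwinnertonDyer.BirchSwinnertonDyer.Theorems.TeichmullerTwistDescent.PeriodLatticeIndexParity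

end
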